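import Mathlib.Analysis.Calculus.ContDiff.Basic
import Mathlib.Analysis.Calculus.Gradient.Basic
import Mathlib.Analysis.InnerProductSpace.PiL2
import HarnessLib

/-!
# Spatial gluing of classical solutions of the isentropic Euler system on `ℝᵈ` (theorems only)

Analysis/FluidPDE support file (everything proved; no definitions, no named facts). The pointwise
form of the isentropic compressible Euler system used upstairs of the flat torus
(`IsentropicEulerPeriodicDescent.lean`: density `P`, velocity `W`, time derivative within a time
set `S`, `∂ₜP + ∑ᵢ ∂ᵢ(P Wᵢ) = 0`, `P ∂ₜW + P (W·∇)W + ∇(P^γ/γ) = 0`) is LOCAL: if `(P, W)` agrees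
with a solution `(P₁, W₁)` on `S × A` and with a solution `(P₂, W₂)` on `S × (ℝᵈ ∖ A)`, where
`A, B` are open, cover `ℝᵈ`, and the two solutions agree on `S × (A ∩ B)`, then `(P, W)` is jointly
smooth on `S × ℝᵈ` and solves the system everywhere (`IsentropicEuler.equations_congr`,
`IsentropicEuler.glue_space`). This is the bookkeeping of the gluing step in the periodic
implosion of Cao-Labora–Gómez-Serrano–Shi–Staffilani, Rem. 1.5 (self-similar solution near the
lattice points, auxiliary periodic solution elsewhere, equal on the overlap by finite speed of
propagation). [folklore] [cite: CaolaboraEtAl2025, Rem. 1.5 p. 7]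
-/

noncomputable section

open Set Filter Topology
open scoped ContDiff

namespace Literature.Analysis.FluidPDE

namespace IsentropicEuler

variable {ι : Type*} [Fintype ι] [DecidableEq ι]

/-- **Locality of the pointwise isentropic Euler equations.** If at a point `(t, z)` the fields
`(P, W)` agree with `(P', W')` for all times at `z` and on a space neighbourhood of `z` at time
`t`, then the mass and momentum equations for `(P', W')` at `(t, z)` imply those for `(P, W)`.
[folklore] -/
theorem equations_congr {S : Set ℝ} {γ : ℝ} {P P' : ℝ → EuclideanSpace ℝ ι → ℝ}
    {W W' : ℝ → EuclideanSpace ℝ ι → EuclideanSpace ℝ ι} {t : ℝ} {z : EuclideanSpace ℝ ι}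
    (hPt : ∀ s, P s z = P' s z) (hWt : ∀ s, W s z = W' s z)
    (hPz : P t =ᶠ[𝓝 z] P' t) (hWz : W t =ᶠ[𝓝 z] W' t)
    (hmass : derivWithin (fun s => P' s z) S t +
      ∑ i, fderiv ℝ (fun w => P' t w * W' t w i) z (EuclideanSpace.single i 1) = 0)
    (hmom : P' t z • derivWithin (fun s => W' s z) S t +
        P' t z • ∑ i, W' t z i • fderiv ℝ (W' t) z (EuclideanSpace.single i 1) +
      gradient (fun w => P' t w ^ γ / γ) z = 0) :
    (derivWithin (fun s => P s z) S t +
      ∑ i, fderiv ℝ (fun w => P t w * W t w i) z (EuclideanSpace.single i 1) = 0) ∧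
    (P t z • derivWithin (fun s => W s z) S t +
        P t z • ∑ i, W t z i • fderiv ℝ (W t) z (EuclideanSpace.single i 1) +
      gradient (fun w => P t w ^ γ / γ) z = 0) := by
  have e1 : (fun s => P s z) = fun s => P' s z := funext hPt
  have e2 : (fun s => W s z) = fun s => W' s z := funext hWt
  have e3 : ∀ i, fderiv ℝ (fun w => P t w * W t w i) z = fderiv ℝ (fun w => P' t w * W' t w i) z := by
    intro i
    refine Filter.EventuallyEq.fderiv_eq ?_
    filter_upwards [hPz, hWz] with w hP hW
    rw [hP, hW]
  have e4 : fderiv ℝ (W t) z = fderiv ℝ (W' t) z := hWz.fderiv_eq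
  have e5 : gradient (fun w => P t w ^ γ / γ) z = gradient (fun w => P' t w ^ γ / γ) z := by
    refine Filter.EventuallyEq.gradient_eq ?_
    filter_upwards [hPz] with w hP
    rw [hP]
  refine ⟨?_, ?_⟩
  · rw [e1, Finset.sum_congr rfl fun i _ => by rw [e3 i]]
    exact hmass
  · rw [e2, e4, e5, hPt t, hWt t]
    exact hmom

/-- **Spatial gluing.** Let `A, B` be open sets covering `ℝᵈ`, `(P₁, W₁)` jointly smooth on
`S × A` and solving the pointwise isentropic equations there, `(P₂, W₂)` the same on `S × B`,
and `P₁ = P₂`, `W₁ = W₂` on `S × (A ∩ B)`. If `(P, W)` equals `(P₁, W₁)` on `ℝ × A` and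
`(P₂, W₂)` on `ℝ × (ℝᵈ ∖ A)`, then `(P, W)` is jointly smooth on `S × ℝᵈ` and solves the
equations at every point of `S × ℝᵈ`. [folklore] [cite: CaolaboraEtAl2025, Rem. 1.5 p. 7] -/
theorem glue_space {S : Set ℝ} {γ : ℝ} {A B : Set (EuclideanSpace ℝ ι)} (hA : IsOpen A)
    (hB : IsOpen B) (hAB : ∀ z, z ∈ A ∨ z ∈ B)
    {P P₁ P₂ : ℝ → EuclideanSpace ℝ ι → ℝ} {W W₁ W₂ : ℝ → EuclideanSpace ℝ ι → EuclideanSpace ℝ ι}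
    (hP₁ : ContDiffOn ℝ ∞ (fun p : ℝ × EuclideanSpace ℝ ι => P₁ p.1 p.2) (S ×ˢ A))
    (hW₁ : ContDiffOn ℝ ∞ (fun p : ℝ × EuclideanSpace ℝ ι => W₁ p.1 p.2) (S ×ˢ A))
    (hP₂ : ContDiffOn ℝ ∞ (fun p : ℝ × EuclideanSpace ℝ ι => P₂ p.1 p.2) (S ×ˢ B))
    (hW₂ : ContDiffOn ℝ ∞ (fun p : ℝ × EuclideanSpace ℝ ι => W₂ p.1 p.2) (S ×ˢ B))
    (hPA : ∀ t z, z ∈ A → P t z = P₁ t z) (hWA : ∀ t z, z ∈ A → W t z = W₁ t z)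
    (hPB : ∀ t z, z ∉ A → P t z = P₂ t z) (hWB : ∀ t z, z ∉ A → W t z = W₂ t z)
    (hagP : ∀ t ∈ S, ∀ z, z ∈ A → z ∈ B → P₁ t z = P₂ t z)
    (hagW : ∀ t ∈ S, ∀ z, z ∈ A → z ∈ B → W₁ t z = W₂ t z)
    (hmass₁ : ∀ t ∈ S, ∀ z ∈ A, derivWithin (fun s => P₁ s z) S t +
      ∑ i, fderiv ℝ (fun w => P₁ t w * W₁ t w i) z (EuclideanSpace.single i 1) = 0)
    (hmom₁ : ∀ t ∈ S, ∀ z ∈ A, P₁ t z • derivWithin (fun s => W₁ s z) S t +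
        P₁ t z • ∑ i, W₁ t z i • fderiv ℝ (W₁ t) z (EuclideanSpace.single i 1) +
      gradient (fun w => P₁ t w ^ γ / γ) z = 0)
    (hmass₂ : ∀ t ∈ S, ∀ z ∈ B, derivWithin (fun s => P₂ s z) S t +
      ∑ i, fderiv ℝ (fun w => P₂ t w * W₂ t w i) z (EuclideanSpace.single i 1) = 0)
    (hmom₂ : ∀ t ∈ S, ∀ z ∈ B, P₂ t z • derivWithin (fun s => W₂ s z) S t +
        P₂ t z • ∑ i, W₂ t z i • fderiv ℝ (W₂ t) z (EuclideanSpace.single i 1) +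
      gradient (fun w => P₂ t w ^ γ / γ) z = 0) :
    ContDiffOn ℝ ∞ (fun p : ℝ × EuclideanSpace ℝ ι => P p.1 p.2) (S ×ˢ univ) ∧
    ContDiffOn ℝ ∞ (fun p : ℝ × EuclideanSpace ℝ ι => W p.1 p.2) (S ×ˢ univ) ∧
    (∀ t ∈ S, ∀ z, derivWithin (fun s => P s z) S t +
      ∑ i, fderiv ℝ (fun w => P t w * W t w i) z (EuclideanSpace.single i 1) = 0) ∧
    (∀ t ∈ S, ∀ z, P t z • derivWithin (fun s => W s z) S t +
        P t z • ∑ i, W t z i • fderiv ℝ (W t) z (EuclideanSpace.single i 1) +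
      gradient (fun w => P t w ^ γ / γ) z = 0) := by
  -- `(P, W) = (P₂, W₂)` on `S × B`
  have hPB' : ∀ t ∈ S, ∀ z ∈ B, P t z = P₂ t z := by
    intro t ht z hz
    by_cases hzA : z ∈ A
    · rw [hPA t z hzA, hagP t ht z hzA hz]
    · exact hPB t z hzA
  have hWB' : ∀ t ∈ S, ∀ z ∈ B, W t z = W₂ t z := by
    intro t ht z hz
    by_cases hzA : z ∈ A
    · rw [hWA t z hzA, hagW t ht z hzA hz]
    · exact hWB t z hzA
  -- set identities
  have hsetA : (S ×ˢ (univ : Set (EuclideanSpace ℝ ι))) ∩ (univ ×ˢ A) = S ×ˢ A := by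
    rw [Set.prod_inter_prod, inter_univ, univ_inter]
  have hsetB : (S ×ˢ (univ : Set (EuclideanSpace ℝ ι))) ∩ (univ ×ˢ B) = S ×ˢ B := by
    rw [Set.prod_inter_prod, inter_univ, univ_inter]
  -- joint smoothness, locally
  have hPs : ContDiffOn ℝ ∞ (fun p : ℝ × EuclideanSpace ℝ ι => P p.1 p.2) (S ×ˢ univ) := by
    refine contDiffOn_of_locally_contDiffOn fun p hp => ?_
    rcases hAB p.2 with h2 | h2
    · refine ⟨univ ×ˢ A, isOpen_univ.prod hA, ⟨mem_univ _, h2⟩, ?_⟩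
      rw [hsetA]
      exact hP₁.congr fun q hq => hPA q.1 q.2 hq.2
    · refine ⟨univ ×ˢ B, isOpen_univ.prod hB, ⟨mem_univ _, h2⟩, ?_⟩
      rw [hsetB]
      exact hP₂.congr fun q hq => hPB' q.1 hq.1 q.2 hq.2
  have hWs : ContDiffOn ℝ ∞ (fun p : ℝ × EuclideanSpace ℝ ι => W p.1 p.2) (S ×ˢ univ) := by
    refine contDiffOn_of_locally_contDiffOn fun p hp => ?_
    rcases hAB p.2 with h2 | h2
    · refine ⟨univ ×ˢ A, isOpen_univ.prod hA, ⟨mem_univ _, h2⟩, ?_⟩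
      rw [hsetA]
      exact hW₁.congr fun q hq => hWA q.1 q.2 hq.2
    · refine ⟨univ ×ˢ B, isOpen_univ.prod hB, ⟨mem_univ _, h2⟩, ?_⟩
      rw [hsetB]
      exact hW₂.congr fun q hq => hWB' q.1 hq.1 q.2 hq.2
  -- the equations, pointwise
  have heqs : ∀ t ∈ S, ∀ z,
      (derivWithin (fun s => P s z) S t +
        ∑ i, fderiv ℝ (fun w => P t w * W t w i) z (EuclideanSpace.single i 1) = 0) ∧
      (P t z • derivWithin (fun s => W s z) S t +
          P t z • ∑ i, W t z i • fderiv ℝ (W t) z (EuclideanSpace.single i 1) +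
        gradient (fun w => P t w ^ γ / γ) z = 0) := by
    intro t ht z
    by_cases hzA : z ∈ A
    · refine equations_congr (fun s => hPA s z hzA) (fun s => hWA s z hzA) ?_ ?_
        (hmass₁ t ht z hzA) (hmom₁ t ht z hzA)
      · filter_upwards [hA.mem_nhds hzA] with w hw using hPA t w hw
      · filter_upwards [hA.mem_nhds hzA] with w hw using hWA t w hw
    · have hzB : z ∈ B := (hAB z).resolve_left hzA
      refine equations_congr (fun s => hPB s z hzA) (fun s => hWB s z hzA) ?_ ?_
        (hmass₂ t ht z hzB) (hmom₂ t ht z hzB)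
      · filter_upwards [hB.mem_nhds hzB] with w hw using hPB' t ht w hw
      · filter_upwards [hB.mem_nhds hzB] with w hw using hWB' t ht w hw
  exact ⟨hPs, hWs, fun t ht z => (heqs t ht z).1, fun t ht z => (heqs t ht z).2⟩

end IsentropicEuler

end Literature.Analysis.FluidPDE
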